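import Summits.BirchSwinnertonDyer.BirchSwinnertonDyer.Theorems.KatoDescentTamePotSupersingularTameFineSelmerClassGroupHomRoad
import Literature.NumberTheory.EllipticCurves.FineSelmerClassGroupCriterionTorsionPointField
import HarnessLib

/-!
# The CLASS-GROUP road to Coates–Sujatha's (A) on a row ITSELF, KT form at odd `p`, with Deo–Ray–Sujatha's
# (c2) DISCHARGED IN THE KERNEL from ONE class number: `p ∤ h(ℚ(P))` for a single non-zero `p`-torsion point
# (route `KatoDescentTamePotSupersingular`, rung KT, cell `bsd-potss`; crux item stmt-BirchSwinnertonDyer-19413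
# `TameFineSelmerCoatesSujatha` (aside) / 19916 `TameCoatesSujathaResidue`; a `--supports … --as helper` file;
# seat `bsd-potss-conjA-anchor` g8; ROUTE-FREE; nothing booked, BSD is not proved by any of this, no item closed)

WHY. The sibling road `TameFineSelmerClassGroupHomRoad.missingUpperBoundAt_addv_of_homTrivialClassGroupCertificate`
(conjA-anchor g7, p562059) DISPLAYS Deo–Ray–Sujatha's hypothesis (c2) `Hom_G(H′_L, E[p]) = 0` as a binder
`hhom`, backed per row by a class-number certificate `5 ∤ h(ℚ(P))` plus a PAPER lemma (memo
`pub/bsd-potss/conjA-anchor/g7/FINDING-19413-…-g7.md` §5) — whence the cell planner's separate tier K′-DRS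
(plan g24, 2026-08-27 19:29:58Z: «Promotion K′ → K for a row needs the kernel discharge
“5 ∤ #G ∧ 5 ∤ h(ℚ(P)) ⟹ (c2)”»). That discharge is now the Literature theorem
`DeoRaySujatha2023.thm39_of_homTrivial_of_classNumber_stabilizerField`
(`Literature/NumberTheory/EllipticCurves/FineSelmerClassGroupCriterionTorsionPointField.lean`, conjA-anchor g8):
this file re-keys the KT road on it. Displayed per-row hypotheses are now ALL numeric: `r_an = 0`, `Addv W p`,
`0 ≤ v_p(j)`, `W[p]` irreducible, (c1) `p ∤ #Gal(ℚ(W[p])/ℚ)`, **`∃ P ∈ W[p] ∖ 0` with `p ∤ h(ℚ(P))`** (`ℚ(P)` =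
the fixed field, inside `ℚ(W[p])`, of the stabiliser of `P`; `[ℚ(P):ℚ] = 8` on `5Ns` rows, `24` on `5Nn/5S4`;
certificates: conjA-anchor g7 kit j283612 / j287355, 41 rows `bnfcertify`d GRH-free, 46 under GRH), and (c3).
HONEST FRAMING: conditional on the displayed named facts (`hDRS` = Deo–Ray–Sujatha Thm. 3.9 (b) with (c2) as
printed, p499746; `hKatoA`, GZK, modularity); on ♯ rows (c3) fails (`sharpRow_exists_local_pTorsion`), so this
road serves ♭ rows only; class-wide the crux is Coates–Sujatha (A), a named open problem.

References: [DeoRaySujatha2023] Thm. 3.8 (c2), Thm. 3.9 (b), Lemma 5.1; [NeukirchANT1999] III (1.6)(iv);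
[Kato2004Asterisque] Thm. 14.5 (3), Prop. 14.16 (2); [CoatesSujatha2005] §3 Conjecture A.
-/

set_option autoImplicit false
-- sibling precedent (`KatoDescentPotSupersingularAssembly.lean`): the directory name repeats the summit name
set_option linter.dupNamespace false

noncomputable section

open scoped Classical nonZeroDivisors NumberField

namespace Summit.BirchSwinnertonDyer.BirchSwinnertonDyer.Theorems.TameFineSelmerClassGroupTorsionPointRoad

open NumberField IsDedekindDomain Field
open WeierstrassCurve Literature.NumberTheory.EllipticCurves
  Literature.NumberTheory.EllipticCurves.GreenbergSelmer
  Literature.NumberTheory.EllipticCurves.IwasawaAlgebra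
  Literature.NumberTheory.EllipticCurves.Rank1Residual
  Literature.NumberTheory.EllipticCurves.Rank1Residual.Typed
  Literature.NumberTheory.EllipticCurves.ZpExtension
  Literature.NumberTheory.GaloisRepresentations
  Summit.BirchSwinnertonDyer.Rank1Residual Summit.BirchSwinnertonDyer.Rank1Residual.Additive
  Summit.BirchSwinnertonDyer.Rank1Residual.O6
  Summit.BirchSwinnertonDyer.BirchSwinnertonDyer.Theorems

/-- **The CLASS-GROUP road, KT row form, (c2) from `p ∤ h(ℚ(P))`.** At an additive, potentially good odd
prime `p` (`Addv W p`, `0 ≤ v_p(j)`), for `W/ℚ` globally minimal with `r_an = 0` and `W[p]` irreducible: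
(c1) `p ∤ #Gal(ℚ(W[p])/ℚ)`, (c2′) some non-zero `P ∈ W[p]` has `p ∤ h(ℚ(P))`, `ℚ(P) ⊆ ℚ(W[p])` the fixed field
of the stabiliser of `P`, (c3) no non-zero `D_v`-fixed `p`-torsion at `v = p` and at the bad places ⟹
`MissingUpperBoundAt W p` — (c2′) ⟹ (c2) in the kernel
(`DeoRaySujatha2023.thm39_of_homTrivial_of_classNumber_stabilizerField`), (A) at `(W,p)` by `hDRS`, then
`TameFineSelmerSupersingularUnitAnchor.missingUpperBoundAt_addv_of_conjA` (Kato's fine reading, GZK, modularity).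
[cite: DeoRaySujatha2023, Thm. 3.8 (c2) and Thm. 3.9 (b) with Lemma 5.1] [cite: NeukirchANT1999, Ch. III §1 Prop. (1.6) (iv)]
[cite: Kato2004Asterisque, Thm. 14.5 (3) and Prop. 14.16 (2)] [cite: CoatesSujatha2005, §3 Conjecture A] -/
theorem missingUpperBoundAt_addv_of_torsionPointClassNumberCertificate
    (hDRS : DeoRaySujatha2023.thm39_fineSelmerDual_moduleFinite_of_homTrivial_divisionField)
    (hKatoA :
      Kato2004.rankZero_padicValNat_sha_add_padicValNat_tamagawa_le_of_additive_potGood_of_irreducible_of_fineSelmerDual_fg)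
    (hGZK : rank_eq_analyticRank_of_analyticRank_le_one) (hmod : hasEntireLFunction_rat)
    (W : WeierstrassCurve ℚ) [W.IsElliptic] [W.IsGloballyMinimal] (p : ℕ) [Fact p.Prime]
    (hr : W.analyticRank = 0) (hp : p ≠ 2) (hA : Addv W p) (hj : 0 ≤ padicValRat p W.j)
    (hirr : W.HasIrreducibleModPGaloisRep p)
    (hG : haveI : NeZero p := ⟨(Fact.out : p.Prime).ne_zero⟩
      ¬ p ∣ Nat.card ((W.divisionField p) ≃ₐ[ℚ] (W.divisionField p)))
    (hP : haveI : NeZero p := ⟨(Fact.out : p.Prime).ne_zero⟩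
      haveI : NumberField (W.divisionField p) := NumberField.mk
      ∃ P : geomTorsion W (p : ℤ), P ≠ 0 ∧
        ¬ p ∣ NumberField.classNumber (IntermediateField.fixedField
          ((MulAction.stabilizer (absoluteGaloisGroup ℚ) P).map
            (absRestrictNormalHom (W.divisionField p)))))
    (hloc : ∀ v : HeightOneSpectrum (𝓞 ℚ), (((p : ℕ) : 𝓞 ℚ) ∈ v.asIdeal ∨ ¬ W.HasGoodReductionAt v) →
      ∀ x : W.geomPrimaryTorsion p, p • x = 0 → (∀ d ∈ decomp v, d • x = x) → x = 0) :
    MissingUpperBoundAt W p :=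
  TameFineSelmerSupersingularUnitAnchor.missingUpperBoundAt_addv_of_conjA hKatoA hGZK hmod W p hr hp hA hj
    hirr (DeoRaySujatha2023.thm39_of_homTrivial_of_classNumber_stabilizerField hDRS W p hp hirr hG hP hloc)

/-- **The (A)-form on ONE row** (the conclusion shape of `stub_fineA_tame_five_le` /
`stub_residue_multiCarrier_anchorOrClassicalMu`'s class-group leg): `∃ γ D, Module.Finite …` for `W` at `p`
from (c1), (c2′) `∃ P ≠ 0, p ∤ h(ℚ(P))`, (c3) — the Literature corollary re-exported in this namespace
(nothing about `r_an`, `Addv` or the image type is needed for (A) itself; valid at `p = 3` for K9 rows too).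
[cite: DeoRaySujatha2023, Thm. 3.8 (c2) and Thm. 3.9 (b) with Lemma 5.1] [cite: NeukirchANT1999, Ch. III §1 Prop. (1.6) (iv)] -/
theorem conjA_of_torsionPointClassNumberCertificate
    (hDRS : DeoRaySujatha2023.thm39_fineSelmerDual_moduleFinite_of_homTrivial_divisionField)
    (W : WeierstrassCurve ℚ) [W.IsElliptic] (p : ℕ) [Fact p.Prime] (hp : p ≠ 2)
    (hirr : W.HasIrreducibleModPGaloisRep p)
    (hG : haveI : NeZero p := ⟨(Fact.out : p.Prime).ne_zero⟩
      ¬ p ∣ Nat.card ((W.divisionField p) ≃ₐ[ℚ] (W.divisionField p)))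
    (hP : haveI : NeZero p := ⟨(Fact.out : p.Prime).ne_zero⟩
      haveI : NumberField (W.divisionField p) := NumberField.mk
      ∃ P : geomTorsion W (p : ℤ), P ≠ 0 ∧
        ¬ p ∣ NumberField.classNumber (IntermediateField.fixedField
          ((MulAction.stabilizer (absoluteGaloisGroup ℚ) P).map
            (absRestrictNormalHom (W.divisionField p)))))
    (hloc : ∀ v : HeightOneSpectrum (𝓞 ℚ), (((p : ℕ) : 𝓞 ℚ) ∈ v.asIdeal ∨ ¬ W.HasGoodReductionAt v) →
      ∀ x : W.geomPrimaryTorsion p, p • x = 0 → (∀ d ∈ decomp v, d • x = x) → x = 0) :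
    ∀ (κ : ZpExtension ℚ p), κ.IsCyclotomic →
      ∃ (γ : Field.absoluteGaloisGroup ℚ) (D : W.FineSelmerDualData κ γ),
        Module.Finite ℤ_[p] (RestrictScalars ℤ_[p] (IwasawaAlgebra p) D.X) :=
  fun κ hκ => DeoRaySujatha2023.thm39_of_homTrivial_of_classNumber_stabilizerField hDRS W p hp hirr hG hP hloc κ hκ

end Summit.BirchSwinnertonDyer.BirchSwinnertonDyer.Theorems.TameFineSelmerClassGroupTorsionPointRoad
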